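import Mathlib
import HarnessLib
import Summits.HubbardSuperconductivity.HubbardSuperconductivity.Theorems.KLProgrammeC4aJointCurvatureCalculus

/-!
# Route `KLProgramme` — crux C4a, S3 brick (B4) «(B4)-UMK1», «(M2)-HESSIAN» part 2 (the model instance under `FrameOK`): JOINT STRONG CONVEXITY in the tube
# angle `ϑ` of the partner-band family `(ϑ,φ) ↦ e_K(c + Φ(ρ,ϑ+θ) − Φ(0,φ+θ))` near an ANTIPODAL-UMKLAPP configuration (`Φ(ρ,ϑ+θ) ≈ −Φ(0,ψ)`,
# `Φ(0,φ+θ) ≈ Φ(0,ψ)`, partner point `≈ Φ(0,ψ)`), with the explicit modulus `(9/400)u_min² − 2ε(Δ, |ρ|, ω)` from the landed rows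

Cell `gate-hubbard-kl`, seat hubbard-kl-k3c3-p3 (g29; row «implicit-function / monotonicity route for μ(n)»).  Located brick for the (C)-closer lane hubbard-kl-c4a-1
(stub (C) `stub_twoLeg_curvature` of `KLRegimeEngineV17F2`, stmt-HubbardSuperconductivity-20437), memo HOME/hubbard-kl-k3c3-p3/U1-CAUSTIC-SUP.md §3 / §7 REMAINING (M2)
first half («joint strong convexity of the partner-band family on a neighbourhood of an antipodal-umklapp configuration, modulus `κ_min(GeomConstants…) > 0`; Hessian
`det = κ²Q_p² + 2λQ_pQ′`, Schur complement `δ₀″ = κ²Q_p/2 + λQ′`, `= 3Q/2` at `ρ = 0`»).  Part 1 (`…C4aJointCurvatureCalculus.convexOn_sub_sq_of_two_curves`) is carrier-free;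
this file feeds it the tree's rows for `f = frameLevel μ K`, `Γ₁ = levelPoint μ K ρ` (the `q′`-curve), `Γ₂ = Γ₀ = levelPoint μ K 0` (the loop curve = the Fermi curve):
`‖Γ_ρ′‖, ‖Γ₀′‖ ≤ D₁`, `‖Γ_ρ″‖, ‖Γ₀″‖ ≤ D₂` (`…C4aPathJets.norm_iteratedDeriv_levelPoint_le`, `D_j = msD A₃ A₄ j`), the half-turn antisymmetry
`Γ₀⁽ⁱ⁾(ψ+π) = −Γ₀⁽ⁱ⁾(ψ)` (`…C4aPathRigidity.iteratedDeriv_levelPoint_add_pi`: the ANTIPODAL reference tangent is the tangent at `ψ + π`), the angular rows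
`‖Γ_ρ⁽ⁱ⁾(s) − Γ_ρ⁽ⁱ⁾(s′)‖ ≤ D_{i+1}|s − s′|` (`norm_iteratedDeriv_levelPoint_sub_le_angle`), the radial rows `‖Γ_ρ′ − Γ₀′‖ ≤ RR₁|ρ|`, `‖Γ_ρ″ − Γ₀″‖ ≤ C₂row|ρ|`
(`…C4aRadialRowOne`, `…C4aRadialRowsTwoThree`), `e_K ∘ Γ₀ ≡ 0` and the curvature floor `Q(ψ) = D²e_K(Γ₀ψ)[Γ₀′ψ,Γ₀′ψ] ≥ (3/200)u_min²` under `FrameOK`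
(`…C4aTangencyCurvatureFloor.curvCoeff_ge_umin_sq_of_frameOK`).
* §1 `ConvexOn.of_sub_sq_le` (a smaller modulus is still a modulus);
* §2 **`convexOn_partnerBand_antipodal_sub_sq`**: on a convex `S ⊆ ℝ×ℝ` with `‖c + Φ(ρ,ϑ+θ) − Φ(0,φ+θ) − Φ(0,ψ)‖ ≤ Δ`, `|ϑ + θ − (ψ + π)| ≤ ω`,
  `|φ + θ − ψ| ≤ ω` for `(ϑ,φ) ∈ S`, and the budget `ε := 2K₃ΔD₁² + 4K₂δD₁ + K₂ΔD₂ + K₁η ≤ (3/2)(3/200)u_min²` (`δ = RR₁|ρ| + D₂ω`, `η = C₂row|ρ| + D₃ω`):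
  `ConvexOn ℝ S ((ϑ,φ) ↦ e_K(c + Φ(ρ,ϑ+θ) − Φ(0,φ+θ)) − ((9/400)u_min² − 2ε)/2·ϑ²)` — the `hg` of `…C4aCausticTouchConvexity.convexOn_partialMin_sub_sq`, so the
  caustic offset `δ₀(ϑ) = min_φ` over the `φ`-window inherits the modulus and «(M2)-DISPATCH» (`…C4aCausticWindowDispatch`) applies with `κ = (9/400)u_min² − 2ε`.
For the umklapp sheet `m` of the pp bubble take `c = Φ(0,θ) − 2πm` (the pair-sum point minus the sheet; `e_K` is `2π`-periodic), `ψ` the loop fold angle of the configuration.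
Hypotheses = those of `…C4aFoldCurvaturePartnerBand` §2.  Bookkeeping on landed objects; nothing about the model's sizes; nothing asserts (C), K3 or superconductivity.
References: FST II CPAM 51 (1998) Lemma 2.1, §3 [cite: FeldmanSalmhoferTrubowitz1998]; BGM 2006 §2.4 (2.40) [cite: BenfattoGiulianiMastropietro2006].
-/

noncomputable section

namespace Summit.HubbardSuperconductivity.HubbardSuperconductivity.Theorems.C4a

set_option linter.dupNamespace false -- summit = problem name (single-conjunct summit), D-0017
set_option maxSynthPendingDepth 3 -- nested operator-norm instances (third Fréchet derivatives)

open Real Set Filter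
open scoped Topology
open Literature.MathematicalPhysics.QuantumLattice Literature.MathematicalPhysics.QuantumLattice.BandSectorCounting Literature.Probability.LatticeModels
open Summit.HubbardSuperconductivity.HubbardSuperconductivity.Theorems.KLRegimeSplit
open Summit.HubbardSuperconductivity.HubbardSuperconductivity.Theorems.DispersionFlow
open Summit.HubbardSuperconductivity.HubbardSuperconductivity.Theorems.PerturbedFermiCurve

/-! ## §1 A smaller modulus is still a modulus -/

/-- If `x ↦ g x − (κ/2)x₁²` is convex on `S` and `κ₀ ≤ κ`, then so is `x ↦ g x − (κ₀/2)x₁²`. -/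
theorem ConvexOn.of_sub_sq_le {g : ℝ × ℝ → ℝ} {S : Set (ℝ × ℝ)} {κ κ₀ : ℝ}
    (h : ConvexOn ℝ S (fun x : ℝ × ℝ => g x - κ / 2 * x.1 ^ 2)) (hle : κ₀ ≤ κ) :
    ConvexOn ℝ S (fun x : ℝ × ℝ => g x - κ₀ / 2 * x.1 ^ 2) := by
  refine ⟨h.1, fun x hx y hy a b ha hb hab => ?_⟩
  have hj := h.2 hx hy ha hb hab
  simp only [smul_eq_mul, Prod.fst_add, Prod.smul_fst] at hj ⊢
  have hb' : b = 1 - a := by linarith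
  have hsq : a * x.1 ^ 2 + b * y.1 ^ 2 - (a * x.1 + b * y.1) ^ 2 = a * b * (x.1 - y.1) ^ 2 := by rw [hb']; ring
  have hnn : 0 ≤ a * b * (x.1 - y.1) ^ 2 := by positivity
  nlinarith [hj, hsq, hnn, hle]

/-! ## §2 The partner-band family near an antipodal-umklapp configuration -/

section Sizes

variable {K : TrigPolyC4v} {A : ℝ} (hA : ∀ p : Momentum, ∀ j ≤ 2, ‖iteratedFDeriv ℝ j (frameShift K) p‖ ≤ A) (hA20 : A ≤ 1 / 20)
  (hd : klCurveD ≤ (bandBounds (show (-4 : ℝ) < -1.1 by norm_num) (show (-1.1 : ℝ) ≤ -0.1 by norm_num)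
    (show (-0.1 : ℝ) < 0 by norm_num)).Dtmin - 2 * A)
  {μ r : ℝ} (hr : 0 < r) (hlo : (-1.1 : ℝ) < μ - r - A) (hhi : μ + r + A < -0.1)
  {A₃ A₄ : ℝ} (hA₃ : ∀ p : Momentum, ‖iteratedFDeriv ℝ 3 (frameShift K) p‖ ≤ A₃)
  (hA₄ : ∀ p : Momentum, ‖iteratedFDeriv ℝ 4 (frameShift K) p‖ ≤ A₄)
  {K₁ K₂ K₃ : ℝ} (hK₁ : ∀ p : Momentum, ‖fderiv ℝ (frameLevel μ K) p‖ ≤ K₁) (hK₂ : ∀ p : Momentum, ‖iteratedFDeriv ℝ 2 (frameLevel μ K) p‖ ≤ K₂)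
  (hK₃ : ∀ p : Momentum, ‖iteratedFDeriv ℝ 3 (frameLevel μ K) p‖ ≤ K₃)
include hA hA20 hd hr hlo hhi hA₃ hA₄ hK₁ hK₂ hK₃

omit hK₁ hK₂ hK₃ in
/-- **The antipodal tangent row**: `‖Γ_ρ′(s) + Γ₀′(ψ)‖ ≤ RR₁|ρ| + D₂·|s − (ψ + π)|` (the reference tangent at `ψ` is minus the tangent at `ψ + π`). -/
theorem norm_iteratedDeriv_one_levelPoint_add_antipodal_le {ρ : ℝ} (hρ : |ρ| < r) (s ψ : ℝ) :
    ‖iteratedDeriv 1 (levelPoint μ K ρ) s + iteratedDeriv 1 (levelPoint μ K 0) ψ‖ ≤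
      radialRowOneConst A ((bandBounds (show (-4 : ℝ) < -1.1 by norm_num) (show (-1.1 : ℝ) ≤ -0.1 by norm_num) (show (-0.1 : ℝ) < 0 by norm_num)).Dtmin - 2 * A) * |ρ| +
        msD A₃ A₄ 2 * |s - (ψ + π)| := by
  have h0 : |(0 : ℝ)| < r := by simpa using hr
  have hanti : iteratedDeriv 1 (levelPoint μ K 0) ψ = -iteratedDeriv 1 (levelPoint μ K 0) (ψ + π) := by
    rw [iteratedDeriv_levelPoint_add_pi, neg_neg]
  have e1 : iteratedDeriv 1 (levelPoint μ K ρ) s + iteratedDeriv 1 (levelPoint μ K 0) ψ =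
      (iteratedDeriv 1 (levelPoint μ K ρ) s - iteratedDeriv 1 (levelPoint μ K 0) s) +
        (iteratedDeriv 1 (levelPoint μ K 0) s - iteratedDeriv 1 (levelPoint μ K 0) (ψ + π)) := by rw [hanti]; abel
  rw [e1]
  exact (norm_add_le _ _).trans (add_le_add (norm_iteratedDeriv_one_levelPoint_sub_le hA hd hr hlo hhi hρ s)
    (norm_iteratedDeriv_levelPoint_sub_le_angle hA hA20 hd hlo hhi hA₃ hA₄ h0 (i := 1) (by norm_num) s (ψ + π)))

omit hK₁ hK₂ hK₃ in
/-- **The antipodal curvature-vector row**: `‖Γ_ρ″(s) + Γ₀″(ψ)‖ ≤ C₂row|ρ| + D₃·|s − (ψ + π)|`. -/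
theorem norm_iteratedDeriv_two_levelPoint_add_antipodal_le {ρ : ℝ} (hρ : |ρ| < r) (s ψ : ℝ) :
    ‖iteratedDeriv 2 (levelPoint μ K ρ) s + iteratedDeriv 2 (levelPoint μ K 0) ψ‖ ≤
      (uRowTwoConst A A₃ ((bandBounds (show (-4 : ℝ) < -1.1 by norm_num) (show (-1.1 : ℝ) ≤ -0.1 by norm_num) (show (-0.1 : ℝ) < 0 by norm_num)).Dtmin - 2 * A) +
          1 / ((bandBounds (show (-4 : ℝ) < -1.1 by norm_num) (show (-1.1 : ℝ) ≤ -0.1 by norm_num) (show (-0.1 : ℝ) < 0 by norm_num)).Dtmin - 2 * A) +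
          2 * (radialRowOneConst A ((bandBounds (show (-4 : ℝ) < -1.1 by norm_num) (show (-1.1 : ℝ) ≤ -0.1 by norm_num) (show (-0.1 : ℝ) < 0 by norm_num)).Dtmin - 2 * A) -
            1 / ((bandBounds (show (-4 : ℝ) < -1.1 by norm_num) (show (-1.1 : ℝ) ≤ -0.1 by norm_num) (show (-0.1 : ℝ) < 0 by norm_num)).Dtmin - 2 * A))) * |ρ| +
        msD A₃ A₄ 3 * |s - (ψ + π)| := by
  have h0 : |(0 : ℝ)| < r := by simpa using hr
  have hanti : iteratedDeriv 2 (levelPoint μ K 0) ψ = -iteratedDeriv 2 (levelPoint μ K 0) (ψ + π) := by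
    rw [iteratedDeriv_levelPoint_add_pi, neg_neg]
  have e1 : iteratedDeriv 2 (levelPoint μ K ρ) s + iteratedDeriv 2 (levelPoint μ K 0) ψ =
      (iteratedDeriv 2 (levelPoint μ K ρ) s - iteratedDeriv 2 (levelPoint μ K 0) s) +
        (iteratedDeriv 2 (levelPoint μ K 0) s - iteratedDeriv 2 (levelPoint μ K 0) (ψ + π)) := by rw [hanti]; abel
  rw [e1]
  exact (norm_add_le _ _).trans (add_le_add (norm_iteratedDeriv_two_levelPoint_sub_le hA hA20 hd hr hlo hhi hA₃ hA₄ hρ s)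
    (norm_iteratedDeriv_levelPoint_sub_le_angle hA hA20 hd hlo hhi hA₃ hA₄ h0 (i := 2) (by norm_num) s (ψ + π)))

/-- **JOINT STRONG CONVEXITY OF THE PARTNER-BAND FAMILY NEAR AN ANTIPODAL-UMKLAPP CONFIGURATION under `FrameOK`.**  `|ρ| < r`, `c` any base point
(`Φ(0,θ) − 2πm` for the umklapp sheet `m`), `θ` the base angle, `ψ` a reference Fermi angle; `S ⊆ ℝ×ℝ` convex with, for `(ϑ,φ) ∈ S`: partner displacement
`‖c + Φ(ρ,ϑ+θ) − Φ(0,φ+θ) − Φ(0,ψ)‖ ≤ Δ`, antipodality `|ϑ + θ − (ψ + π)| ≤ ω`, loop proximity `|φ + θ − ψ| ≤ ω`; `d = Dt_min − 2A`, `D_j = msD A₃ A₄ j`,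
`RR₁ = radialRowOneConst A d`, `C₂row = uRowTwoConst A A₃ d + 1/d + 2(RR₁ − 1/d)`, `δ = RR₁|ρ| + D₂ω`, `η = C₂row|ρ| + D₃ω`,
`ε = 2K₃ΔD₁² + 4K₂δD₁ + K₂ΔD₂ + K₁η`; budget `ε ≤ (3/2)·(3/200)u_min²`.  THEN
`ConvexOn ℝ S ((ϑ,φ) ↦ e_K(c + Φ(ρ,ϑ+θ) − Φ(0,φ+θ)) − ((9/400)u_min² − 2ε)/2·ϑ²)`. -/
theorem convexOn_partnerBand_antipodal_sub_sq {R : RenConsts} {U : ℝ} {N : ℕ} (hF : FrameOK R U N μ K) {ρ : ℝ} (hρ : |ρ| < r)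
    (c : Momentum) (θ ψ : ℝ) {S : Set (ℝ × ℝ)} (hS : Convex ℝ S) {Δ ω : ℝ}
    (hΔ : ∀ x ∈ S, ‖c + (levelPoint μ K ρ (x.1 + θ) - levelPoint μ K 0 (x.2 + θ)) - levelPoint μ K 0 ψ‖ ≤ Δ)
    (hω₁ : ∀ x ∈ S, |x.1 + θ - (ψ + π)| ≤ ω) (hω₂ : ∀ x ∈ S, |x.2 + θ - ψ| ≤ ω)
    (hbudget : 2 * K₃ * Δ * msD A₃ A₄ 1 ^ 2 +
        4 * K₂ * (radialRowOneConst A ((bandBounds (show (-4 : ℝ) < -1.1 by norm_num) (show (-1.1 : ℝ) ≤ -0.1 by norm_num) (show (-0.1 : ℝ) < 0 by norm_num)).Dtmin - 2 * A) * |ρ| +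
          msD A₃ A₄ 2 * ω) * msD A₃ A₄ 1 +
        K₂ * Δ * msD A₃ A₄ 2 +
        K₁ * ((uRowTwoConst A A₃ ((bandBounds (show (-4 : ℝ) < -1.1 by norm_num) (show (-1.1 : ℝ) ≤ -0.1 by norm_num) (show (-0.1 : ℝ) < 0 by norm_num)).Dtmin - 2 * A) +
              1 / ((bandBounds (show (-4 : ℝ) < -1.1 by norm_num) (show (-1.1 : ℝ) ≤ -0.1 by norm_num) (show (-0.1 : ℝ) < 0 by norm_num)).Dtmin - 2 * A) +
              2 * (radialRowOneConst A ((bandBounds (show (-4 : ℝ) < -1.1 by norm_num) (show (-1.1 : ℝ) ≤ -0.1 by norm_num) (show (-0.1 : ℝ) < 0 by norm_num)).Dtmin - 2 * A) -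
                1 / ((bandBounds (show (-4 : ℝ) < -1.1 by norm_num) (show (-1.1 : ℝ) ≤ -0.1 by norm_num) (show (-0.1 : ℝ) < 0 by norm_num)).Dtmin - 2 * A))) * |ρ| +
            msD A₃ A₄ 3 * ω) ≤
      3 / 2 * (3 / 200 * (bandBounds (show (-4 : ℝ) < -1.1 by norm_num) (show (-1.1 : ℝ) ≤ -0.1 by norm_num) (show (-0.1 : ℝ) < 0 by norm_num)).umin ^ 2)) :
    ConvexOn ℝ S (fun x : ℝ × ℝ => frameLevel μ K (c + (levelPoint μ K ρ (x.1 + θ) - levelPoint μ K 0 (x.2 + θ))) -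
      (9 / 400 * (bandBounds (show (-4 : ℝ) < -1.1 by norm_num) (show (-1.1 : ℝ) ≤ -0.1 by norm_num) (show (-0.1 : ℝ) < 0 by norm_num)).umin ^ 2 -
        2 * (2 * K₃ * Δ * msD A₃ A₄ 1 ^ 2 +
          4 * K₂ * (radialRowOneConst A ((bandBounds (show (-4 : ℝ) < -1.1 by norm_num) (show (-1.1 : ℝ) ≤ -0.1 by norm_num) (show (-0.1 : ℝ) < 0 by norm_num)).Dtmin - 2 * A) * |ρ| +
            msD A₃ A₄ 2 * ω) * msD A₃ A₄ 1 +
          K₂ * Δ * msD A₃ A₄ 2 +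
          K₁ * ((uRowTwoConst A A₃ ((bandBounds (show (-4 : ℝ) < -1.1 by norm_num) (show (-1.1 : ℝ) ≤ -0.1 by norm_num) (show (-0.1 : ℝ) < 0 by norm_num)).Dtmin - 2 * A) +
                1 / ((bandBounds (show (-4 : ℝ) < -1.1 by norm_num) (show (-1.1 : ℝ) ≤ -0.1 by norm_num) (show (-0.1 : ℝ) < 0 by norm_num)).Dtmin - 2 * A) +
                2 * (radialRowOneConst A ((bandBounds (show (-4 : ℝ) < -1.1 by norm_num) (show (-1.1 : ℝ) ≤ -0.1 by norm_num) (show (-0.1 : ℝ) < 0 by norm_num)).Dtmin - 2 * A) -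
                  1 / ((bandBounds (show (-4 : ℝ) < -1.1 by norm_num) (show (-1.1 : ℝ) ≤ -0.1 by norm_num) (show (-0.1 : ℝ) < 0 by norm_num)).Dtmin - 2 * A))) * |ρ| +
              msD A₃ A₄ 3 * ω))) / 2 * x.1 ^ 2) := by
  set B₀ := bandBounds (show (-4 : ℝ) < -1.1 by norm_num) (show (-1.1 : ℝ) ≤ -0.1 by norm_num) (show (-0.1 : ℝ) < 0 by norm_num) with hB₀
  set dd : ℝ := B₀.Dtmin - 2 * A with hdd
  set RR₁ : ℝ := radialRowOneConst A dd with hRR₁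
  set C₂row : ℝ := uRowTwoConst A A₃ dd + 1 / dd + 2 * (RR₁ - 1 / dd) with hC₂row
  set δ : ℝ := RR₁ * |ρ| + msD A₃ A₄ 2 * ω with hδ
  set η : ℝ := C₂row * |ρ| + msD A₃ A₄ 3 * ω with hη
  set ε : ℝ := 2 * K₃ * Δ * msD A₃ A₄ 1 ^ 2 + 4 * K₂ * δ * msD A₃ A₄ 1 + K₂ * Δ * msD A₃ A₄ 2 + K₁ * η with hε
  have hADt : 2 * A < B₀.Dtmin := by have := klCurveD_pos; linarith
  have h0 : |(0 : ℝ)| < r := by simpa using hr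
  -- curves, sizes, level
  have hΓρ : ContDiff ℝ 4 (levelPoint μ K ρ) := contDiff_levelPoint_angle B₀ hA hADt hlo hhi hρ
  have hΓ0 : ContDiff ℝ 4 (levelPoint μ K 0) := contDiff_levelPoint_angle B₀ hA hADt hlo hhi h0
  have hD1 := fun s => norm_iteratedDeriv_levelPoint_le hA hA20 hd hlo hhi hA₃ hA₄ hρ le_rfl (by norm_num) s
  have hD1' := fun s => norm_iteratedDeriv_levelPoint_le hA hA20 hd hlo hhi hA₃ hA₄ h0 le_rfl (by norm_num) s
  have hD2 := fun s => norm_iteratedDeriv_levelPoint_le hA hA20 hd hlo hhi hA₃ hA₄ hρ (i := 2) (by norm_num) (by norm_num) s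
  have hD2' := fun s => norm_iteratedDeriv_levelPoint_le hA hA20 hd hlo hhi hA₃ hA₄ h0 (i := 2) (by norm_num) (by norm_num) s
  have hlev := fun s => frameLevel_levelPoint_zero B₀ hA hr hlo hhi s
  have hD20 : 0 ≤ msD A₃ A₄ 2 := (norm_nonneg _).trans (hD2 0)
  have hD30 : 0 ≤ msD A₃ A₄ 3 := by
    have h := norm_iteratedDeriv_levelPoint_sub_le_angle hA hA20 hd hlo hhi hA₃ hA₄ h0 (i := 2) (by norm_num) (1 : ℝ) 0
    rw [sub_zero, abs_one, mul_one] at h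
    exact (norm_nonneg _).trans h
  have hRRρ : 0 ≤ RR₁ * |ρ| := (norm_nonneg _).trans (norm_iteratedDeriv_one_levelPoint_sub_le hA hd hr hlo hhi hρ 0)
  have hC₂ρ : 0 ≤ C₂row * |ρ| := (norm_nonneg _).trans (norm_iteratedDeriv_two_levelPoint_sub_le hA hA20 hd hr hlo hhi hA₃ hA₄ hρ 0)
  -- the displacement rows on `S`
  have rδ₁ : ∀ x ∈ S, ‖iteratedDeriv 1 (levelPoint μ K ρ) (x.1 + θ) + iteratedDeriv 1 (levelPoint μ K 0) ψ‖ ≤ δ := fun x hx =>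
    (norm_iteratedDeriv_one_levelPoint_add_antipodal_le hA hA20 hd hr hlo hhi hA₃ hA₄ hρ (x.1 + θ) ψ).trans
      (add_le_add le_rfl (mul_le_mul_of_nonneg_left (hω₁ x hx) hD20))
  have rδ₂ : ∀ x ∈ S, ‖iteratedDeriv 1 (levelPoint μ K 0) (x.2 + θ) - iteratedDeriv 1 (levelPoint μ K 0) ψ‖ ≤ δ := fun x hx => by
    have h := norm_iteratedDeriv_levelPoint_sub_le_angle hA hA20 hd hlo hhi hA₃ hA₄ h0 (i := 1) (by norm_num) (x.2 + θ) ψ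
    have h2 : msD A₃ A₄ 2 * |x.2 + θ - ψ| ≤ msD A₃ A₄ 2 * ω := mul_le_mul_of_nonneg_left (hω₂ x hx) hD20
    simp only [hδ]; linarith
  have rη₁ : ∀ x ∈ S, ‖iteratedDeriv 2 (levelPoint μ K ρ) (x.1 + θ) + iteratedDeriv 2 (levelPoint μ K 0) ψ‖ ≤ η := fun x hx =>
    (norm_iteratedDeriv_two_levelPoint_add_antipodal_le hA hA20 hd hr hlo hhi hA₃ hA₄ hρ (x.1 + θ) ψ).trans
      (add_le_add le_rfl (mul_le_mul_of_nonneg_left (hω₁ x hx) hD30))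
  have rη₂ : ∀ x ∈ S, ‖iteratedDeriv 2 (levelPoint μ K 0) (x.2 + θ) - iteratedDeriv 2 (levelPoint μ K 0) ψ‖ ≤ η := fun x hx => by
    have h := norm_iteratedDeriv_levelPoint_sub_le_angle hA hA20 hd hlo hhi hA₃ hA₄ h0 (i := 2) (by norm_num) (x.2 + θ) ψ
    have h2 : msD A₃ A₄ 3 * |x.2 + θ - ψ| ≤ msD A₃ A₄ 3 * ω := mul_le_mul_of_nonneg_left (hω₂ x hx) hD30
    simp only [hη]; linarith
  -- the curvature floor and the budget
  have hfloor := curvCoeff_ge_umin_sq_of_frameOK hA hd hr hlo hhi hF ψ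
  have hupos := B₀.umin_pos
  have hQ : 0 < fderiv ℝ (fderiv ℝ (frameLevel μ K)) (levelPoint μ K 0 ψ) (iteratedDeriv 1 (levelPoint μ K 0) ψ) (iteratedDeriv 1 (levelPoint μ K 0) ψ) :=
    lt_of_lt_of_le (by positivity) hfloor
  have hbudget' : ε ≤ 3 / 2 * fderiv ℝ (fderiv ℝ (frameLevel μ K)) (levelPoint μ K 0 ψ) (iteratedDeriv 1 (levelPoint μ K 0) ψ) (iteratedDeriv 1 (levelPoint μ K 0) ψ) :=
    hbudget.trans (by linarith)
  have hmain := convexOn_sub_sq_of_two_curves (EngineV8.contDiff_frameLevel μ K) hK₁ hK₂ hK₃ hΓρ hΓ0 hΓ0 hlev hD1 hD1' (hD1' ψ) hD2 hD2'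
    (c := c) (θ := θ) (G := fun x : ℝ × ℝ => frameLevel μ K (c + (levelPoint μ K ρ (x.1 + θ) - levelPoint μ K 0 (x.2 + θ)))) (fun _ => rfl)
    hS hΔ rδ₁ rδ₂ rη₁ rη₂ hQ hbudget'
  exact ConvexOn.of_sub_sq_le hmain (by linarith)

end Sizes

end Summit.HubbardSuperconductivity.HubbardSuperconductivity.Theorems.C4a

end
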